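import Literature.Combinatorics.SimpleGraph.LittleTheorem
import Literature.Combinatorics.SimpleGraph.MatchingMinorPfaffian
import Literature.Combinatorics.SimpleGraph.PfaffianBicontractionReflect
import Literature.Combinatorics.SimpleGraph.MatchingMinorLift
import Literature.Combinatorics.SimpleGraph.BicontractionNormalPosition
import HarnessLib

/-!
# Little's theorem: reduction of the hard direction to minimal non-Pfaffian graphs

Topic `Combinatorics/SimpleGraph`; theorems only. The named fact
`Little1975_isPfaffianBipartite_iff_not_isMatchingMinor` (`LittleTheorem.lean`) is
`IsPfaffianBipartite G ↔ ¬ IsMatchingMinor K_{3,3} G`; "→" is `MatchingMinorPfaffian.lean`. This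
file reduces "←" — every non-Pfaffian bipartite graph has a `K_{3,3}` matching minor (Little
1975, Theorem 1 / Corollary 1) — to its combinatorial core, the analysis of a MINIMAL non-Pfaffian
bipartite graph, by the descending induction along matching minors that every proof of Little's
theorem begins with (Little 1975 §4: "we may as well assume `G` is connected … every edge belongs
to a directed circuit"; Seymour–Thomassen 1987, proof of Thm 4.1: "a counterexample with the
smallest number of vertices"):

* `hard_direction_of_core` — by strong induction on `n + #G`: if deleting an edge keeps `G`
  non-Pfaffian, recurse (`IsMatchingMinor.mono`); if a proper central subgraph is non-Pfaffian,
  recurse (`IsCentralSubgraph.isMatchingMinor_trans`); a row or column of degree `0` contradicts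
  non-Pfaffian-ness (no perfect matching), of degree `1` is removed with its partner (the shift,
  `IsPfaffianBipartite.of_shift`, `IsMatchingMinor.of_shift`) after deleting the partner's other
  edges (they lie on no perfect matching), of degree `2` is bicontracted in normal position
  (`exists_relabel_rowZeroBicontractible`, `isPfaffianBipartite_bicontractRowZero_iff`,
  `IsMatchingMinor.of_bicontractRowZero`); otherwise a perfect matching is moved onto the diagonal
  and the CORE hypothesis applies: *a non-Pfaffian `G ⊇ diagonal` all of whose one-edge-deleted
  subgraphs and proper central subgraphs are Pfaffian and all of whose vertices have degree `≥ 3`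
  has a `K_{3,3}` matching minor* (in fact is `K_{3,3}`; Little 1975 Thm 1, Seymour–Thomassen
  1987 Thm 4.1 in the digraph translation of `PfaffianDicycles.lean`);
* `little1975_of_core` — hence the named fact follows from the core statement.

The core statement is taken here as an explicit hypothesis of these two theorems (it is NOT
posited as a fact); its proof is the remaining work of the discharge.

## References

* C. H. C. Little, *A characterization of convertible (0,1)-matrices*, J. Combin. Theory Ser. B
  18 (1975) 187–208, Theorem 1, Corollary 1, §4. [Little1975]
* N. Robertson, P. D. Seymour, R. Thomas, *Permanents, Pfaffian orientations, and even directed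
  circuits*, Ann. of Math. 150 (1999) 929–975, (1.2), §4. [RobertsonSeymourThomas1999]
-/

namespace Literature.Combinatorics.SimpleGraph

open Equiv Finset

/-! ### Small bookkeeping lemmas -/

section Bookkeeping

variable {k n : ℕ}

/-- A central subgraph has at most as many edges as its host. [folklore] -/
theorem IsCentralSubgraph.card_le {K : Finset (Fin k × Fin k)} {G : Finset (Fin n × Fin n)}
    (h : IsCentralSubgraph K G) : K.card ≤ G.card := by
  obtain ⟨r, c, hK, -, -⟩ := h
  calc K.card = (K.map ⟨fun e => (r e.1, c e.2), fun e e' he => Prod.ext (r.injective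
        (Prod.ext_iff.1 he).1) (c.injective (Prod.ext_iff.1 he).2)⟩).card := (Finset.card_map _).symm
    _ ≤ G.card := Finset.card_le_card fun x hx => by
        obtain ⟨e, he, rfl⟩ := Finset.mem_map.1 hx
        exact hK e he

/-- Relabelling preserves the number of edges. [folklore] -/
theorem card_relabel (G : Finset (Fin n × Fin n)) (ρ κ : Perm (Fin n)) :
    (relabel G ρ κ).card = G.card :=
  Finset.card_map _

/-- Transposition preserves the number of edges. [folklore] -/
theorem card_transposeEdges (G : Finset (Fin n × Fin n)) : (transposeEdges G).card = G.card :=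
  Finset.card_map _

/-- The bicontraction has at most as many edges. [folklore] -/
theorem card_bicontractRowZero_le {m : ℕ} (G : Finset (Fin (m + 2) × Fin (m + 2))) :
    (bicontractRowZero G).card ≤ G.card :=
  Finset.card_image_le.trans (Finset.card_filter_le _ _)

/-- Relabelling commutes with deleting an edge. [folklore] -/
theorem relabel_erase (G : Finset (Fin n × Fin n)) (ρ κ : Perm (Fin n)) (e : Fin n × Fin n) :
    relabel (G.erase e) ρ κ = (relabel G ρ κ).erase (ρ e.1, κ e.2) := by
  ext x
  simp only [mem_relabel_iff, Finset.mem_erase, ne_eq]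
  constructor
  · rintro ⟨hne, hx⟩
    refine ⟨fun h => hne ?_, hx⟩
    rw [h]; simp
  · rintro ⟨hne, hx⟩
    refine ⟨fun h => hne ?_, hx⟩
    rw [Prod.ext_iff] at h ⊢
    simp only at h
    exact ⟨by rw [← h.1]; simp, by rw [← h.2]; simp⟩

/-- Transposition commutes with deleting an edge. [folklore] -/
theorem transposeEdges_erase (G : Finset (Fin n × Fin n)) (e : Fin n × Fin n) :
    transposeEdges (G.erase e) = (transposeEdges G).erase (e.2, e.1) := by
  ext x
  simp only [mem_transposeEdges_iff, Finset.mem_erase, ne_eq, Prod.ext_iff]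
  tauto

/-- If every perfect matching of `G` avoids the edge `e`, then `G` is Pfaffian as soon as
`G.erase e` is (same perfect matchings). [folklore] -/
theorem IsPfaffianBipartite.of_erase {G : Finset (Fin n × Fin n)} {e : Fin n × Fin n}
    (havoid : ∀ σ : Perm (Fin n), (∀ i, (i, σ i) ∈ G) → σ e.1 ≠ e.2)
    (h : IsPfaffianBipartite (G.erase e)) : IsPfaffianBipartite G := by
  obtain ⟨s, hs⟩ := h
  refine ⟨s, fun σ hσ => hs σ fun i => Finset.mem_erase.2 ⟨fun hi => ?_, hσ i⟩⟩
  have h1 : i = e.1 := (Prod.ext_iff.1 hi).1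
  subst h1
  exact havoid σ hσ (Prod.ext_iff.1 hi).2

/-- The diagonal becomes a perfect matching after relabelling the columns by the inverse of a
perfect matching. [folklore] -/
theorem diag_mem_relabel_of_perfectMatching {G : Finset (Fin n × Fin n)} {σ₀ : Perm (Fin n)}
    (hσ₀ : ∀ i, (i, σ₀ i) ∈ G) (i : Fin n) : (i, i) ∈ relabel G (Equiv.refl _) σ₀.symm := by
  rw [mem_relabel_iff]
  simpa using hσ₀ i

end Bookkeeping

/-! ### The reduction -/

section Reduction

/-- **The hard direction of Little's theorem, reduced to minimal non-Pfaffian graphs.** Assume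
the CORE: every non-Pfaffian `G ⊆ Fin n × Fin n` containing the diagonal, all of whose
one-edge-deleted subgraphs are Pfaffian, all of whose proper central subgraphs are Pfaffian, and
all of whose rows and columns have degree at least `3`, has a `K_{3,3}` matching minor. Then
EVERY non-Pfaffian bipartite graph has a `K_{3,3}` matching minor (Little 1975, Corollary 1 with
Robertson–Seymour–Thomas (4.2)). Proof: strong induction on `n + #G` along edge deletions,
central subgraphs, shifts of degree-one vertices and bicontractions of degree-two vertices.
[cite: Little1975, Theorem 1 and Corollary 1] -/
theorem hard_direction_of_core
    (hcore : ∀ (n : ℕ) (G : Finset (Fin n × Fin n)),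
      (∀ i, (i, i) ∈ G) → ¬ IsPfaffianBipartite G →
      (∀ e ∈ G, IsPfaffianBipartite (G.erase e)) →
      (∀ (k : ℕ) (K : Finset (Fin k × Fin k)), k < n → IsCentralSubgraph K G →
        IsPfaffianBipartite K) →
      (∀ i, 3 ≤ (G.filter fun e => e.1 = i).card) →
      (∀ j, 3 ≤ (G.filter fun e => e.2 = j).card) →
      IsMatchingMinor (Finset.univ : Finset (Fin 3 × Fin 3)) G)
    {n : ℕ} (G : Finset (Fin n × Fin n)) (hG : ¬ IsPfaffianBipartite G) :
    IsMatchingMinor (Finset.univ : Finset (Fin 3 × Fin 3)) G := by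
  classical
  -- strong induction on `n + #G`
  suffices main : ∀ (N : ℕ) (n : ℕ) (G : Finset (Fin n × Fin n)), n + G.card = N →
      ¬ IsPfaffianBipartite G → IsMatchingMinor (Finset.univ : Finset (Fin 3 × Fin 3)) G from
    main _ n G rfl hG
  intro N
  induction N using Nat.strong_induction_on with
  | _ N ih =>
  intro n G hN hG
  -- `n ≥ 3`, since smaller graphs are Pfaffian
  have hn3 : 3 ≤ n := by
    by_contra hlt
    exact hG (isPfaffianBipartite_of_lt_three (not_le.1 hlt) G)
  obtain ⟨m, rfl⟩ := Nat.exists_eq_add_of_le' hn3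
  -- (del) if deleting an edge keeps `G` non-Pfaffian, recurse
  by_cases hdel : ∃ e ∈ G, ¬ IsPfaffianBipartite (G.erase e)
  · obtain ⟨e, he, hGe⟩ := hdel
    have hlt : (m + 3) + (G.erase e).card < N := by
      rw [← hN, Finset.card_erase_of_mem he]
      have := Finset.card_pos.2 ⟨e, he⟩
      omega
    exact (ih _ hlt (m + 3) (G.erase e) rfl hGe).mono (Finset.erase_subset e G)
  have hdelG : ∀ e ∈ G, IsPfaffianBipartite (G.erase e) := fun e he =>
    not_not.1 fun h => hdel ⟨e, he, h⟩
  -- (cen) if a proper central subgraph is non-Pfaffian, recurse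
  by_cases hcen : ∃ (k : ℕ) (K : Finset (Fin k × Fin k)), k < m + 3 ∧ IsCentralSubgraph K G ∧
      ¬ IsPfaffianBipartite K
  · obtain ⟨k, K, hk, hKG, hK⟩ := hcen
    have hlt : k + K.card < N := by
      rw [← hN]
      have := hKG.card_le
      omega
    exact hKG.isMatchingMinor_trans (ih _ hlt k K rfl hK)
  have hcenG : ∀ (k : ℕ) (K : Finset (Fin k × Fin k)), k < m + 3 → IsCentralSubgraph K G →
      IsPfaffianBipartite K := fun k K hk hKG => not_not.1 fun hK => hcen ⟨k, K, hk, hKG, hK⟩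
  -- rows of degree at most two
  have row_case : ∀ (G' : Finset (Fin (m + 3) × Fin (m + 3))), G'.card = G.card →
      ¬ IsPfaffianBipartite G' → (∀ e ∈ G', IsPfaffianBipartite (G'.erase e)) →
      ∀ i : Fin (m + 3), (G'.filter fun e => e.1 = i).card ≤ 2 →
      IsMatchingMinor (Finset.univ : Finset (Fin 3 × Fin 3)) G' := by
    intro G' hcard hG' hdel' i hi
    rcases Nat.lt_or_ge (G'.filter fun e => e.1 = i).card 2 with hlt2 | hge2
    · rcases Nat.lt_or_ge (G'.filter fun e => e.1 = i).card 1 with hlt1 | hge1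
      · -- degree 0: no perfect matching
        exfalso
        refine hG' (isPfaffianBipartite_of_forall_exists_not_mem fun σ => ⟨i, fun hmem => ?_⟩)
        have : (i, σ i) ∈ G'.filter fun e => e.1 = i := Finset.mem_filter.2 ⟨hmem, rfl⟩
        rw [Finset.card_eq_zero.1 (Nat.lt_one_iff.1 hlt1)] at this
        simp at this
      · -- degree 1
        have h1 : (G'.filter fun e => e.1 = i).card = 1 := by omega
        obtain ⟨e₀, he₀⟩ := Finset.card_eq_one.1 h1
        have he₀i : e₀ = (i, e₀.2) :=
          eq_mk_of_mem_filter_fst (G := G') (by rw [he₀]; exact Finset.mem_singleton_self _)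
        set j₀ := e₀.2 with hj₀
        have hrowi : ∀ j, (i, j) ∈ G' → j = j₀ := by
          intro j hj
          have : (i, j) ∈ G'.filter fun e => e.1 = i := Finset.mem_filter.2 ⟨hj, rfl⟩
          rw [he₀, Finset.mem_singleton, he₀i] at this
          exact (Prod.ext_iff.1 this).2
        have hij : (i, j₀) ∈ G' := by
          have : e₀ ∈ G'.filter fun e => e.1 = i := by rw [he₀]; exact Finset.mem_singleton_self _
          rw [he₀i] at this
          exact (Finset.mem_filter.1 this).1
        -- every perfect matching matches `i` with `j₀`
        have hforce : ∀ σ : Perm (Fin (m + 3)), (∀ x, (x, σ x) ∈ G') → σ i = j₀ :=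
          fun σ hσ => hrowi _ (hσ i)
        by_cases hcol : ∃ i', i' ≠ i ∧ (i', j₀) ∈ G'
        · -- another edge at column `j₀`: it lies on no perfect matching, contradiction
          exfalso
          obtain ⟨i', hi'i, hi'⟩ := hcol
          refine hG' (IsPfaffianBipartite.of_erase (e := (i', j₀)) (fun σ hσ h => ?_)
            (hdel' _ hi'))
          exact hi'i (σ.injective (h.trans (hforce σ hσ).symm))
        · -- column `j₀` has degree one too: shift away row `i` and column `j₀`
          have hcolj : ∀ i', (i', j₀) ∈ G' → i' = i := fun i' h =>
            by_contra fun hne => hcol ⟨i', hne, h⟩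
          obtain ⟨hr0, hc0, h00⟩ := relabel_swap_degree_one hrowi hcolj hij
          set G₁ := relabel G' (swap i 0) (swap j₀ 0) with hG₁
          have hG₁P : ¬ IsPfaffianBipartite G₁ := fun h =>
            hG' ((isIsomorphic_relabel G' (swap i 0) (swap j₀ 0)).isPfaffianBipartite_iff.2 h)
          have hKP : ¬ IsPfaffianBipartite (bicontractRowZero G₁) := fun h =>
            hG₁P (IsPfaffianBipartite.of_shift hr0 hc0 h)
          have hlt : (m + 2) + (bicontractRowZero G₁).card < N := by
            rw [← hN, ← hcard]
            have h1 := card_bicontractRowZero_le G₁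
            have h2 : G₁.card = G'.card := by rw [hG₁, card_relabel]
            omega
          have hK := ih _ hlt (m + 2) (bicontractRowZero G₁) rfl hKP
          exact (IsMatchingMinor.of_shift hc0 h00 hK).of_relabel_host
    · -- degree 2: bicontract in normal position
      have h2 : (G'.filter fun e => e.1 = i).card = 2 := le_antisymm hi hge2
      obtain ⟨ρ, κ, hrow⟩ := exists_relabel_rowZeroBicontractible h2
      set G₁ := relabel G' ρ κ with hG₁
      have hG₁P : ¬ IsPfaffianBipartite G₁ := fun h =>
        hG' ((isIsomorphic_relabel G' ρ κ).isPfaffianBipartite_iff.2 h)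
      have hKP : ¬ IsPfaffianBipartite (bicontractRowZero G₁) := fun h =>
        hG₁P ((isPfaffianBipartite_bicontractRowZero_iff hrow).1 h)
      have hlt : (m + 2) + (bicontractRowZero G₁).card < N := by
        rw [← hN, ← hcard]
        have h1 := card_bicontractRowZero_le G₁
        have h2 : G₁.card = G'.card := by rw [hG₁, card_relabel]
        omega
      have hK := ih _ hlt (m + 2) (bicontractRowZero G₁) rfl hKP
      exact (IsMatchingMinor.of_bicontractRowZero hrow hK).of_relabel_host
  by_cases hrow : ∃ i, (G.filter fun e => e.1 = i).card ≤ 2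
  · obtain ⟨i, hi⟩ := hrow
    exact row_case G rfl hG hdelG i hi
  have hrowG : ∀ i, 3 ≤ (G.filter fun e => e.1 = i).card := fun i => by
    by_contra h
    exact hrow ⟨i, by omega⟩
  -- columns of degree at most two, through the transpose
  by_cases hcol : ∃ j, (G.filter fun e => e.2 = j).card ≤ 2
  · obtain ⟨j, hj⟩ := hcol
    rw [card_filter_snd_eq_card_filter_fst_transposeEdges] at hj
    have hGt : ¬ IsPfaffianBipartite (transposeEdges G) := fun h =>
      hG ((isIsomorphic_transposeEdges G).isPfaffianBipartite_iff.2 h)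
    have hdelt : ∀ e ∈ transposeEdges G, IsPfaffianBipartite ((transposeEdges G).erase e) := by
      intro e he
      rw [mem_transposeEdges_iff] at he
      have h1 := hdelG _ he
      rw [show (transposeEdges G).erase e = transposeEdges (G.erase (e.2, e.1)) by
        rw [transposeEdges_erase]]
      exact (isIsomorphic_transposeEdges _).isPfaffianBipartite h1
    exact (row_case (transposeEdges G) (card_transposeEdges G) hGt hdelt j hj).of_transposeEdges_host
  have hcolG : ∀ j, 3 ≤ (G.filter fun e => e.2 = j).card := fun j => by
    by_contra h
    exact hcol ⟨j, by omega⟩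
  -- a perfect matching exists; move it onto the diagonal and apply the core
  by_cases hPM : ∃ σ₀ : Perm (Fin (m + 3)), ∀ i, (i, σ₀ i) ∈ G
  swap
  · exfalso
    exact hG (isPfaffianBipartite_of_forall_exists_not_mem fun σ =>
      not_forall.1 fun h => hPM ⟨σ, h⟩)
  obtain ⟨σ₀, hσ₀⟩ := hPM
  set G₂ := relabel G (Equiv.refl _) σ₀.symm with hG₂
  have hdiag : ∀ i, (i, i) ∈ G₂ := diag_mem_relabel_of_perfectMatching hσ₀
  have hG₂P : ¬ IsPfaffianBipartite G₂ := fun h =>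
    hG ((isIsomorphic_relabel G (Equiv.refl _) σ₀.symm).isPfaffianBipartite_iff.2 h)
  have hdel₂ : ∀ e ∈ G₂, IsPfaffianBipartite (G₂.erase e) := by
    intro e he
    have he' : (e.1, σ₀ e.2) ∈ G := by
      rw [hG₂, mem_relabel_iff] at he
      simpa using he
    have h1 := hdelG _ he'
    have heq : G₂.erase e = relabel (G.erase (e.1, σ₀ e.2)) (Equiv.refl _) σ₀.symm := by
      rw [relabel_erase]
      simp [hG₂]
    rw [heq]
    exact (isIsomorphic_relabel _ _ _).isPfaffianBipartite h1
  have hcen₂ : ∀ (k : ℕ) (K : Finset (Fin k × Fin k)), k < m + 3 → IsCentralSubgraph K G₂ →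
      IsPfaffianBipartite K := by
    intro k K hk hK
    apply hcenG k K hk
    have h1 := hK.relabel_host (Equiv.refl _).symm σ₀.symm.symm
    rwa [hG₂, relabel_relabel_symm] at h1
  have hrow₂ : ∀ i, 3 ≤ (G₂.filter fun e => e.1 = i).card := by
    intro i
    have h1 := card_filter_fst_relabel G (Equiv.refl _) σ₀.symm i
    simp only [Equiv.refl_apply] at h1
    rw [hG₂, h1]
    exact hrowG i
  have hcol₂ : ∀ j, 3 ≤ (G₂.filter fun e => e.2 = j).card := by
    intro j
    have h1 := card_filter_snd_relabel G (Equiv.refl _) σ₀.symm (σ₀ j)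
    simp only [Equiv.symm_apply_apply] at h1
    rw [hG₂, h1]
    exact hcolG (σ₀ j)
  exact (hcore (m + 3) G₂ hdiag hG₂P hdel₂ hcen₂ hrow₂ hcol₂).of_relabel_host

/-- **Little's theorem follows from its core.** With the easy direction
(`IsPfaffianBipartite.not_isMatchingMinor_univ_fin_three`, `MatchingMinorPfaffian.lean`) and the
reduction `hard_direction_of_core`, the named fact
`Little1975_isPfaffianBipartite_iff_not_isMatchingMinor` is a consequence of the core statement on
minimal non-Pfaffian bipartite graphs. [cite: Little1975, Theorem 1 and Corollary 1] -/
theorem little1975_of_core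
    (hcore : ∀ (n : ℕ) (G : Finset (Fin n × Fin n)),
      (∀ i, (i, i) ∈ G) → ¬ IsPfaffianBipartite G →
      (∀ e ∈ G, IsPfaffianBipartite (G.erase e)) →
      (∀ (k : ℕ) (K : Finset (Fin k × Fin k)), k < n → IsCentralSubgraph K G →
        IsPfaffianBipartite K) →
      (∀ i, 3 ≤ (G.filter fun e => e.1 = i).card) →
      (∀ j, 3 ≤ (G.filter fun e => e.2 = j).card) →
      IsMatchingMinor (Finset.univ : Finset (Fin 3 × Fin 3)) G) :
    Little1975_isPfaffianBipartite_iff_not_isMatchingMinor :=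
  fun G => ⟨fun h => h.not_isMatchingMinor_univ_fin_three,
    fun h => by_contra fun hG => h (hard_direction_of_core hcore G hG)⟩

end Reduction

end Literature.Combinatorics.SimpleGraph
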